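import Mathlib
import HarnessLib
import Literature.Analysis.FluidPDE.SelfSimilar
import Literature.Analysis.FluidPDE.VectorCalculus
import Literature.Analysis.FluidPDE.OseenMildUniqueness
import Literature.Analysis.UnboundedOperators.HeatKernel
import Summits.NavierStokesRegularity.NavierStokesRegularity.Theorems.LocalSineTubeDoorProfileAlignedWindowRigidityAncient
import Summits.NavierStokesRegularity.NavierStokesRegularity.Theorems.ImplosionDoorTangentialCurlFreeTrivialityKinematics

/-!
# `ImplosionDoor.TangentialCurlFreeTriviality` (stmt-NavierStokesRegularity-25306) — line `birth`,
# research stub `stub_sliceZero` PROVED: a sphere-tangential profile of the Type-I ancient Oseen-mild class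
# with zero radial vorticity moment vanishes on every negative slice

Registered stub of the skeleton of record `Cruxes/TangentialCurlFreeTriviality/Lines/birth` (planner ns-idea-6,
`TangentialCurlFreeTriviality_birth_g3.lean`, sha 988c162e…), VERBATIM, so the line's `sorry` at `stub_sliceZero`
closes by `exact …Theorems.ImplosionDoorTangentialCurlFreeTrivialityStubSliceZero.stub_sliceZero`.

PROOF.  The class (Type-I rate, continuity on the open slab, unit-viscosity Oseen-mild identity) is jointly
real-analytic on the open slab (tree `…LocalSineTubeDoorProfileAlignedWindowRigidityAncient.analyticOnNhd_slice`,
from Lemarié-Rieusset 2016 Thm 9.12 as PROVED in the tree + bounded-mild uniqueness), so every slice `v(s,·)`,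
`s < 0`, is `C^∞`; its pointwise `div = 0`, tangency `⟪v(s,y), y⟫ = 0` and zero radial vorticity
`⟪curl v(s)(y), y⟫ = 0` are then honest, and the KINEMATIC RIGIDITY theorem
`…TangentialCurlFreeTrivialityKinematics.eq_zero_of_tangential_divFree_radialCurlFree` (harmonic 1-forms on `S²`
vanish — Bochner's identity in ambient coordinates) gives `v(s,·) ≡ 0`.  The divergence-free hypothesis is used;
the Type-I rate enters only through boundedness on sub-slabs (analyticity of the class).

HONEST FRAMING: a statement about HYPOTHETICAL blow-up profiles (slices of a KNSS-type ancient mild solution under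
the door hypotheses); nothing here bears on Navier–Stokes regularity; no summit statement is proved.
-/

noncomputable section

-- the summit and its single sub-problem share the name (CONVENTIONS §1), as in every Theorems file
set_option linter.dupNamespace false

namespace Summit.NavierStokesRegularity.NavierStokesRegularity.Theorems.ImplosionDoorTangentialCurlFreeTrivialityStubSliceZero

open Set Function
open scoped RealInnerProductSpace InnerProductSpace
open Literature.Analysis Literature.Analysis.FluidPDE
open Summit.NavierStokesRegularity.NavierStokesRegularity.Theorems.LocalSineTubeDoorProfileAlignedWindowRigidityAncient
open Summit.NavierStokesRegularity.NavierStokesRegularity.Theorems.ImplosionDoorTangentialCurlFreeTrivialityKinematics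

/-- **Stub `stub_sliceZero` of line `birth` (crux `TangentialCurlFreeTriviality`, stmt-25306), VERBATIM**: a
profile of the route's Type-I ancient Oseen-mild class that is sphere-tangential and has zero radial vorticity
moment vanishes on every negative slice (analytic slices + kinematic rigidity of tangential, divergence-free,
radially curl-free fields). [cite: Davidson2001, App. (poloidal–toroidal kinematics); folklore] -/
theorem stub_sliceZero : ∀ (C : ℝ) (v : ℝ → EuclideanSpace ℝ (Fin 3) → EuclideanSpace ℝ (Fin 3)), Literature.Analysis.FluidPDE.HasTypeITimeDecay C v → ContinuousOn (Function.uncurry v) (Set.Iio (0 : ℝ) ×ˢ Set.univ) → (∀ s t : ℝ, s < t → t < 0 → ∀ x, v t x = Literature.Analysis.UnboundedOperators.heatExtension (v s) (t - s) x - Literature.Analysis.FluidPDE.oseenDuhamel 1 s v v t x) → (∀ t < 0, Literature.Analysis.FluidPDE.VectorCalculus.IsDivFree (v t)) → (∀ s < 0, ∀ y, ⟪v s y, y⟫_ℝ = 0) → (∀ s < 0, ∀ y, ⟪Literature.Analysis.FluidPDE.curl (v s) y, y⟫_ℝ = 0) → ∀ s < 0, ∀ y, v s y = 0 := by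
  intro C v hrate hcont hmild hdiv htan hrad s hs y
  -- slices of the class are real-analytic, hence `C²`
  have han : AnalyticOnNhd ℝ (v s) univ := analyticOnNhd_slice hcont (bdd_of_hasTypeITimeDecay hrate) hmild hs
  have hC2 : ContDiff ℝ 2 (v s) := han.contDiff
  -- kinematic rigidity of the slice
  have h0 : v s = 0 := eq_zero_of_tangential_divFree_radialCurlFree hC2 (htan s hs) (hdiv s hs) (hrad s hs)
  rw [h0]
  rfl

end Summit.NavierStokesRegularity.NavierStokesRegularity.Theorems.ImplosionDoorTangentialCurlFreeTrivialityStubSliceZero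

end
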